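import Literature.NumberTheory.Sieve.MoebiusShiftedPrimesMajorArcs
import Literature.NumberTheory.Sieve.MoebiusShiftedPrimesMinorArc
import HarnessLib

/-!
# Möbius on shifted primes — the major arcs of Lichtman 2020 by pieces of length `1/|θ|`
# (Proposition 2.3 with the printed typical set from a WEAK form of Proposition 3.4)

Topic `Literature/NumberTheory/Sieve`.  Everything in this file is PROVED; it introduces no
definition and no named fact.  It serves the discharge of the named fact
`Literature.NumberTheory.Sieve.Lichtman2020_keyFourierEstimateLiouville'` (J. D. Lichtman,
*Averages of the Möbius function on shifted primes*, Q. J. Math. 73 (2022) 729–757,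
doi:10.1093/qmath/haab054, arXiv:2009.08969v2 [Lichtman2020], Proposition 2.3 in the regime
`H ≤ exp((log X)^{2/3})`, with the PRINTED typical set `S = S(X,A,δ)` of (2.3)–(2.4),
`P₁ = (log X)^{33A}`; file `MoebiusShiftedPrimesArcs.lean`).  Page numbers refer to the held copy
`paper:arxiv-2009.08969`.

## Why this file exists

The tree proves Proposition 2.3 ⇐ Proposition 3.1 (minor arcs, PROVED for the printed set,
`Lichtman2020_minorArcEstimate_holds`) + Proposition 3.2 (major arcs) and Proposition 3.2 ⇐
Proposition 3.4 (`Lichtman2020_majorArcEstimate_of_liouvilleMeanSquare`), but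
`MoebiusShiftedPrimesTypical.lean` records a gap in the printed proof of Proposition 5.1 at the
printed first exponent `P₁ = (log X)^{33A}`: the printed route to Proposition 3.4 (saving `W^{10}`,
`W = (log X)^A`) needs `P₁ ≥ (log X)^{cA}` with `c` about `100`, and the tree re-targets the whole
chain along corrected sets `S_c`, `c ≥ 100`.  For the PRINTED set the following re-balancing of
§3.2 rescues Proposition 2.3 (which only asks for `HX/(d^{3/4}W^{1/5})`, not for the `HX/(dW)` of
Proposition 3.2).  On a major arc `α = a/q + θ`, `q ≤ W`, `|θ| ≤ W⁴/(qH)`, the paper removes the twist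
`e(mθ)` by ONE Abel summation over the whole window of `H/d` integers ((3.9), p. 10), which costs the
factor `|θ|H/d ≤ W⁴/(qd)` and forces the saving `W⁵` in (3.10) and `W^{10}` in Proposition 3.4.
Cutting the window instead into consecutive pieces of `p ≍ min(H/d, 1/|θ|)` integers and applying
Abel summation on each piece costs nothing (`|e(θ) - 1| p ≤ 2π`), and the major arcs are
`≪ HX/(dW^{1/5})` as soon as
`I_h := ∑_{n₀ ≤ N} |∑_{n₀ ≤ m ≤ n₀+h, m ∈ S} λ(m)e(ma/q)| ≪ q h X/(d W^{6/5})` for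
`h ∈ [qH/W^{21/5}, H/d]`, i.e. (residues, gcd, characters, dyadic Cauchy–Schwarz exactly as on
pp. 10–11) as soon as the mean square of Proposition 3.4 is `≪ h²Y/W^{12/5}` for
`h ∈ [H/W^{21/5}, H]` — a WEAK form of Proposition 3.4 (saving `W^{12/5}` instead of `W^{10}`, on
the narrower range `h ≥ H/W^{21/5} ≥ H/W⁵`), which the printed method (Proposition 5.1 via
Lemmas 4.1, 4.3–4.8, the Parseval bound) does reach at `P₁ = (log X)^{33A}` once its parameters are
re-balanced (saving `(log X)^{-14A/5}` in Proposition 5.1, `V = (log X)^{14A/5}`, `α = 1/7`,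
`T₀ = (log X)^{5A}`); that deduction is not part of this file, which takes the weak Proposition 3.4
as an explicit hypothesis.

## Content (all PROVED)

* `Lichtman2020.norm_sum_Icc_le_sum_pieces` — splitting a window into pieces of `p` integers.
* `Lichtman2020.sum_plainWindow_le_gen`, `Lichtman2020.sum_twistedWindow_le_gen` — the tree's
  `sum_plainWindow_le`, `sum_twistedWindow_le` ((3.11)–(3.13)) with the range of window lengths
  (`h ≥ h₀`) and the saving (`w`) as free parameters.
* `Lichtman2020.majorArc_pieces_bound` — the major arc bound at a fixed scale:
  `∑_{k ≤ X} |∑_{k ≤ md ≤ k+H-1, m ∈ S} λ(m)e(mα)| ≤ (3+2π)(32+24√C) HX/(d v)` from the weak mean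
  square hypothesis with parameters `(W, v)` (`v = W^{1/5}` in the application).
* `Lichtman2020.majorArcWeak_of_meanSquareWeak` — the asymptotic form: the weak Proposition 3.4
  (saving `(log X)^{12A/5}`, `h ∈ [H/(log X)^{21A/5}, H]`, `Y ∈ [X/(log X)^{6A}, X]`) implies
  `sup_{α ∈ 𝔐} ∫_0^X |∑_{x ≤ nd ≤ x+H, n ∈ S_d} λ(n)e(nα)| dx ≪ HX/(d W^{1/5})`.
* `Lichtman2020_keyFourierEstimateLiouville'_of_meanSquareWeak` — Proposition 2.3 (regime
  `H ≤ exp((log X)^{2/3})`, printed typical set) from the weak Proposition 3.4, the minor arcs being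
  the tree's `Lichtman2020_minorArcEstimate_holds`.

## Source

* J. D. Lichtman, arXiv:2009.08969v2, §3.2 "Proof of Proposition 3.2 from Proposition 3.4",
  (3.8)–(3.13), pp. 10–11; §3 p. 9 (deduction of Proposition 2.3) [Lichtman2020].  The piecewise
  Abel summation replacing (3.9) is ours (standard); everything else follows the printed steps.
-/

namespace Literature.NumberTheory.Sieve

open Filter Asymptotics Finset MeasureTheory
open scoped FourierTransform Topology

namespace Lichtman2020

/-! ### Splitting a window into pieces -/

/-- **Pieces of `p` integers**: if every sum of `g` over a piece `{s, …, s+j}` with `j = p-1` or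
`j = n mod p` is at most `Φ(s)`, then `|∑_{s ≤ m ≤ s+n} g(m)| ≤ ∑_{i ≤ n/p} Φ(s + ip)`
(cut `{s, …, s+n}` into consecutive pieces of `p` integers, the last one having `n mod p + 1`).
[folklore] -/
theorem norm_sum_Icc_le_sum_pieces (g : ℕ → ℂ) {p : ℕ} (hp : 1 ≤ p) (Φ : ℕ → ℝ) (n : ℕ)
    (hΦ : ∀ s j, (j = p - 1 ∨ j = n % p) → ‖∑ m ∈ Icc s (s + j), g m‖ ≤ Φ s) (s : ℕ) :
    ‖∑ m ∈ Icc s (s + n), g m‖ ≤ ∑ i ∈ range (n / p + 1), Φ (s + i * p) := by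
  induction n using Nat.strong_induction_on generalizing s with
  | _ n ih =>
    rcases lt_or_ge n p with hnp | hnp
    · -- a single piece
      have h1 : n / p = 0 := Nat.div_eq_of_lt hnp
      have h2 : n % p = n := Nat.mod_eq_of_lt hnp
      rw [h1, zero_add, Finset.sum_range_one, zero_mul, add_zero]
      exact hΦ s n (Or.inr h2.symm)
    · -- split off the first piece `{s, …, s + p - 1}`
      have hsplit : Icc s (s + n) = Icc s (s + (p - 1)) ∪ Icc (s + p) (s + p + (n - p)) := by
        ext m; simp only [Finset.mem_union, Finset.mem_Icc]; omega
      have hdisj : Disjoint (Icc s (s + (p - 1))) (Icc (s + p) (s + p + (n - p))) := by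
        rw [Finset.disjoint_left]
        intro m h1 h2
        rw [Finset.mem_Icc] at h1 h2
        omega
      rw [hsplit, Finset.sum_union hdisj]
      refine (norm_add_le _ _).trans ?_
      have hlt : n - p < n := by omega
      have hmod : (n - p) % p = n % p := by
        conv_rhs => rw [show n = n - p + p by omega, Nat.add_mod_right]
      have ih' := ih (n - p) hlt (fun s' j hj => hΦ s' j (by rwa [hmod] at hj)) (s + p)
      have hdiv : n / p = (n - p) / p + 1 := by
        conv_lhs => rw [show n = n - p + p by omega, Nat.add_div_right _ (by omega)]
      rw [hdiv, Finset.sum_range_succ' _ ((n - p) / p + 1)]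
      simp only [zero_mul, add_zero]
      have e : ∀ i : ℕ, s + p + i * p = s + (i + 1) * p := fun i => by ring
      simp only [e] at ih'
      linarith [hΦ s (p - 1) (Or.inl rfl)]

/-! ### The window sums of `λχ` and of `λ e(·a/q)` with free range and saving -/

open ArithmeticFunction in
/-- **The plain-window sum of `λχ` on average**, the tree's `sum_plainWindow_le` with a free
saving `w > 0`: if `∑_{Y < m₀ ≤ 2Y} |∑_{m₀ ≤ m ≤ m₀+ℓ, m ∈ S} λχ(m)|² ≤ C(ℓ+1)²Y/w²` for all integers
`M₀ ≤ Y ≤ N`, then `∑_{m₀ ≤ N} |∑_{m₀ ≤ m ≤ m₀+ℓ, m ∈ S} λ(m)χ(m)| ≤ (ℓ+1)(M₀ + 2√C N/w)`.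
[cite: Lichtman2020, §3.2, (3.13)] -/
theorem sum_plainWindow_le_gen {n : ℕ} (χ : DirichletCharacter ℂ n) (S : ℕ → Prop) [DecidablePred S]
    {ℓ M₀ N : ℕ} {C w : ℝ} (hM : 1 ≤ M₀) (hC : 0 ≤ C) (hw : 0 < w)
    (hms : ∀ Y : ℕ, M₀ ≤ Y → Y ≤ N →
      ∑ k ∈ Ioc Y (2 * Y), ‖∑ m ∈ (Icc k (k + ℓ)).filter S,
          χ (m : ZMod n) * ((liouville m : ℤ) : ℂ)‖ ^ 2 ≤ C * (((ℓ : ℝ) + 1) ^ 2 * Y / w ^ 2)) :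
    ∑ m₀ ∈ Icc 1 N, ‖∑ m ∈ (Icc m₀ (m₀ + ℓ)).filter S, χ (m : ZMod n) * ((liouville m : ℤ) : ℂ)‖ ≤
      ((ℓ : ℝ) + 1) * (M₀ + 2 * Real.sqrt C * N / w) := by
  have hK : 0 ≤ C * ((ℓ : ℝ) + 1) ^ 2 / w ^ 2 := by positivity
  have h := sum_Icc_le_of_dyadic (Q := fun m₀ => ‖∑ m ∈ (Icc m₀ (m₀ + ℓ)).filter S,
      χ (m : ZMod n) * ((liouville m : ℤ) : ℂ)‖) (B := (ℓ : ℝ) + 1)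
      (K := C * ((ℓ : ℝ) + 1) ^ 2 / w ^ 2) (M₀ := M₀) (N := N) (fun _ => norm_nonneg _)
      (fun m₀ => norm_sum_filter_Icc_le m₀ ℓ _ (norm_char_mul_liouville_le_one χ) S) hM hK
      (fun Y h1 h2 => by
        have := hms Y h1 h2
        calc _ ≤ C * (((ℓ : ℝ) + 1) ^ 2 * Y / w ^ 2) := this
          _ = C * ((ℓ : ℝ) + 1) ^ 2 / w ^ 2 * Y := by ring)
  have hsqrt : Real.sqrt (C * ((ℓ : ℝ) + 1) ^ 2 / w ^ 2) = Real.sqrt C * (ℓ + 1) / w := by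
    rw [show C * ((ℓ : ℝ) + 1) ^ 2 / w ^ 2 = C * (((ℓ : ℝ) + 1) / w) ^ 2 by ring,
      Real.sqrt_mul hC, Real.sqrt_sq (by positivity)]
    ring
  rw [hsqrt] at h
  calc _ ≤ (M₀ : ℝ) * ((ℓ : ℝ) + 1) + 2 * (Real.sqrt C * (ℓ + 1) / w) * N := h
    _ = ((ℓ : ℝ) + 1) * (M₀ + 2 * Real.sqrt C * N / w) := by ring

open ArithmeticFunction in
/-- **The bound for `U(j)`** ((3.11)–(3.13) summed over residues, divisors and characters), the
tree's `sum_twistedWindow_le` with a free lower limit `h₀ ≥ 0` of the window lengths and a free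
saving `w > 0`: for `q ≥ 1`, a set `S` invariant under the divisors of `q`, `j` with
`q(h₀ + 1) ≤ j ≤ H - 1`, and the mean-square bound `≤ C h² Y/w²` for the moduli `q/c`, the window
lengths `h ∈ [h₀, H]` and the blocks `M₀ ≤ Y ≤ N`,
`∑_{n₀ ≤ N} |∑_{n₀ ≤ m ≤ n₀+j, m ∈ S} λ(m) e(ma/q)| ≤ 3jq (M₀ + 2√C N/w)`.
[cite: Lichtman2020, §3.2, (3.11)–(3.13)] -/
theorem sum_twistedWindow_le_gen {q N M₀ H j : ℕ} {a : ℤ} {C w h₀ : ℝ} (S : ℕ → Prop)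
    [DecidablePred S] (hq : 0 < q) (hS : ∀ c ∈ q.divisors, ∀ m, S (c * m) ↔ S m) (hw : 0 < w)
    (hC : 0 ≤ C) (hh₀ : 0 ≤ h₀) (hM : 1 ≤ M₀) (hN : 1 ≤ N) (hjlo : (q : ℝ) * (h₀ + 1) ≤ j)
    (hjhi : j + 1 ≤ H)
    (h34 : ∀ c ∈ q.divisors, ∀ χ : DirichletCharacter ℂ (q / c), ∀ h : ℕ,
      h₀ ≤ h → h ≤ H → ∀ Y : ℕ, M₀ ≤ Y → Y ≤ N →
        ∑ k ∈ Ioc Y (2 * Y), ‖∑ m ∈ (Icc k (k + h - 1)).filter S,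
            χ (m : ZMod (q / c)) * ((liouville m : ℤ) : ℂ)‖ ^ 2 ≤ C * ((h : ℝ) ^ 2 * Y / w ^ 2)) :
    ∑ n₀ ∈ Icc 1 N, ‖∑ m ∈ (Icc n₀ (n₀ + j)).filter S,
        ((liouville m : ℤ) : ℂ) * (𝐞 ((m : ℝ) * (a / q)) : ℂ)‖ ≤
      3 * j * q * (M₀ + 2 * Real.sqrt C * N / w) := by
  have hq1 : (1 : ℝ) ≤ q := by exact_mod_cast hq
  have hqj : q ≤ j := by
    have : (q : ℝ) ≤ j := by nlinarith
    exact_mod_cast this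
  set R : ℝ := (M₀ : ℝ) + 2 * Real.sqrt C * N / w with hR
  have hR0 : 0 ≤ R := by positivity
  -- step 1: residues, gcd, characters (pointwise in `n₀`), then swap the sums
  calc ∑ n₀ ∈ Icc 1 N, ‖∑ m ∈ (Icc n₀ (n₀ + j)).filter S,
          ((liouville m : ℤ) : ℂ) * (𝐞 ((m : ℝ) * (a / q)) : ℂ)‖
      ≤ ∑ n₀ ∈ Icc 1 N, ∑ c ∈ q.divisors, ∑ χ : DirichletCharacter ℂ (q / c),
          ‖∑ m ∈ (Icc ((n₀ + c - 1) / c) ((n₀ + j) / c)).filter S,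
            χ (m : ZMod (q / c)) * ((liouville m : ℤ) : ℂ)‖ :=
        Finset.sum_le_sum fun n₀ _ => norm_twistedWindow_le_sum_divisors hq a S hS _ _
    _ = ∑ c ∈ q.divisors, ∑ χ : DirichletCharacter ℂ (q / c), ∑ n₀ ∈ Icc 1 N,
          ‖∑ m ∈ (Icc ((n₀ + c - 1) / c) ((n₀ + j) / c)).filter S,
            χ (m : ZMod (q / c)) * ((liouville m : ℤ) : ℂ)‖ := by
        rw [Finset.sum_comm]
        exact Finset.sum_congr rfl fun c _ => Finset.sum_comm
    _ ≤ ∑ c ∈ q.divisors, ∑ _χ : DirichletCharacter ℂ (q / c), ((j : ℝ) + 2 * c) * R := by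
        refine Finset.sum_le_sum fun c hc => Finset.sum_le_sum fun χ _ => ?_
        have hc0 : 0 < c := Nat.pos_of_mem_divisors hc
        have hcq : c ≤ q := Nat.divisor_le hc
        have hc0' : (0 : ℝ) < c := by exact_mod_cast hc0
        -- step 2: divided windows → plain windows
        refine (sum_window_cdiv_le hc0 N j (fun s => ‖∑ m ∈ s.filter S,
          χ (m : ZMod (q / c)) * ((liouville m : ℤ) : ℂ)‖) (fun _ => norm_nonneg _)
          (by simp)).trans ?_
        -- step 3: each residue `r` is a plain-window average of admissible length
        have hr : ∀ r ∈ range c,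
            ∑ m₀ ∈ Icc 1 ((N - 1) / c + 1), ‖∑ m ∈ (Icc m₀ (m₀ + ((r + j) / c -
              if r = 0 then 0 else 1))).filter S, χ (m : ZMod (q / c)) * ((liouville m : ℤ) : ℂ)‖ ≤
              ((j : ℝ) / c + 2) * R := by
          intro r hr
          rw [Finset.mem_range] at hr
          set ℓ : ℕ := (r + j) / c - if r = 0 then 0 else 1 with hℓ
          have hℓj : (r + j) / c ≤ j := add_div_le_of_le hc0 hr (hcq.trans hqj)
          have hℓle : ℓ ≤ (r + j) / c := Nat.sub_le _ _
          have hℓge : j / q ≤ ℓ + 1 := by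
            have h1 : j / q ≤ j / c := Nat.div_le_div_left hcq hc0
            have h2 : j / c ≤ (r + j) / c := Nat.div_le_div_right (by omega)
            rw [hℓ]; split_ifs <;> omega
          have hlen_hi : ℓ + 1 ≤ H := by omega
          have hlen_lo : h₀ ≤ ((ℓ + 1 : ℕ) : ℝ) := by
            have hdm := Nat.div_add_mod j q
            have hmod := Nat.mod_lt j hq
            have e1 : (q : ℝ) * ((j / q : ℕ) : ℝ) + ((j % q : ℕ) : ℝ) = j := by exact_mod_cast hdm
            have e2 : ((j % q : ℕ) : ℝ) + 1 ≤ q := by exact_mod_cast hmod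
            have e3 : ((j / q : ℕ) : ℝ) ≤ ℓ + 1 := by exact_mod_cast hℓge
            have hq0 : (0 : ℝ) < q := by linarith
            have e4 : (q : ℝ) * h₀ + 1 ≤ (q : ℝ) * ((j / q : ℕ) : ℝ) := by nlinarith
            have e5 : h₀ ≤ ((j / q : ℕ) : ℝ) := by
              by_contra hcon
              push Not at hcon
              nlinarith
            push_cast
            linarith
          have hlen2 : ((ℓ : ℝ) + 1) ≤ (j : ℝ) / c + 2 := by
            have e1 : (ℓ : ℝ) ≤ (((r + j) / c : ℕ) : ℝ) := by exact_mod_cast hℓle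
            have e2 : (((r + j) / c : ℕ) : ℝ) ≤ ((r + j : ℕ) : ℝ) / c := Nat.cast_div_le
            have e3 : ((r + j : ℕ) : ℝ) / c ≤ (j : ℝ) / c + 1 := by
              rw [div_add_one hc0'.ne', div_le_div_iff_of_pos_right hc0']
              push_cast
              have : (r : ℝ) ≤ c := by exact_mod_cast hr.le
              linarith
            linarith
          have hNc : (N - 1) / c + 1 ≤ N := by
            have := Nat.div_le_self (N - 1) c
            omega
          -- the mean-square bound for this character and this window length
          have hV := sum_plainWindow_le_gen χ S (ℓ := ℓ) (M₀ := M₀) (N := (N - 1) / c + 1) (C := C)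
            (w := w) hM hC hw (fun Y h1 h2 => by
              have h := h34 c hc χ (ℓ + 1) hlen_lo hlen_hi Y h1 (h2.trans hNc)
              have hkey : ∀ k : ℕ, k + (ℓ + 1) - 1 = k + ℓ := fun k => by omega
              simp only [hkey] at h
              push_cast at h
              exact h)
          refine hV.trans ?_
          have hNc' : (((N - 1) / c + 1 : ℕ) : ℝ) ≤ N := by exact_mod_cast hNc
          calc ((ℓ : ℝ) + 1) * (M₀ + 2 * Real.sqrt C * (((N - 1) / c + 1 : ℕ) : ℝ) / w)
              ≤ ((ℓ : ℝ) + 1) * R := by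
                refine mul_le_mul_of_nonneg_left ?_ (by positivity)
                rw [hR]
                gcongr
            _ ≤ ((j : ℝ) / c + 2) * R := mul_le_mul_of_nonneg_right hlen2 hR0
        refine (Finset.sum_le_sum hr).trans (le_of_eq ?_)
        rw [Finset.sum_const, Finset.card_range, nsmul_eq_mul]
        field_simp
    _ ≤ ∑ c ∈ q.divisors, ((q / c).totient : ℝ) * (((j : ℝ) + 2 * q) * R) := by
        refine Finset.sum_le_sum fun c hc => ?_
        have hc0 : 0 < c := Nat.pos_of_mem_divisors hc
        have hcq : c ≤ q := Nat.divisor_le hc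
        haveI : NeZero (q / c) :=
          ⟨(Nat.div_pos (Nat.le_of_dvd hq (Nat.dvd_of_mem_divisors hc)) hc0).ne'⟩
        rw [Finset.sum_const, Finset.card_univ, ← Nat.card_eq_fintype_card,
          DirichletCharacter.card_eq_totient_of_hasEnoughRootsOfUnity ℂ (q / c), nsmul_eq_mul]
        refine mul_le_mul_of_nonneg_left (mul_le_mul_of_nonneg_right ?_ hR0) (Nat.cast_nonneg _)
        have : (c : ℝ) ≤ q := by exact_mod_cast hcq
        linarith
    _ = q * (((j : ℝ) + 2 * q) * R) := by rw [← Finset.sum_mul, sum_divisors_totient_div]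
    _ ≤ q * ((3 * j) * R) := by
        refine mul_le_mul_of_nonneg_left (mul_le_mul_of_nonneg_right ?_ hR0) (by positivity)
        have : (q : ℝ) ≤ j := by exact_mod_cast hqj
        linarith
    _ = 3 * j * q * R := by ring

/-! ### Numerics of the pieces -/

/-- The four terms of the piecewise major arc bound, in units of `U = HX/(dv)`:
`(L/p + 1) d [N(T+1) + 3pq(M₀ + 2√C N/(Wv)) + Lp] ≤ (32 + 24√C) U`. [folklore] -/
theorem pieces_major_numerics {W v H X d q p L N M₀ T C : ℝ} (hW : 2 ≤ W) (hv : 1 ≤ v) (hvW : v ≤ W)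
    (hd1 : 1 ≤ d) (hdW : d ≤ W) (hq1 : 1 ≤ q) (hqW : q ≤ W) (hH : W ^ 5 * v ≤ H) (hX : H * W ≤ X)
    (hp1 : 1 ≤ p) (hpL : p ≤ L) (hL : L ≤ H / d) (hN0 : 0 ≤ N) (hdN : d * N ≤ 2 * X)
    (hM₀0 : 0 ≤ M₀) (hdM₀ : d * M₀ ≤ X / (W * v) + d) (hT : T = q * (H / (W ^ 4 * v) + 1))
    (hp3 : q * (H / (W ^ 4 * v)) ≤ 2 * p / v) :
    (L / p + 1) * d * (N * (T + 1) + 3 * p * q * (M₀ + 2 * Real.sqrt C * N / (W * v)) + L * p) ≤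
      (32 + 24 * Real.sqrt C) * (H * X / (d * v)) := by
  have hW0 : 0 < W := by linarith
  have hW1 : 1 ≤ W := by linarith
  have hv0 : 0 < v := by linarith
  have hd0 : 0 < d := by linarith
  have hq0 : 0 < q := by linarith
  have hp0 : 0 < p := by linarith
  have hL0 : 0 < L := by linarith
  have hsC : 0 ≤ Real.sqrt C := Real.sqrt_nonneg C
  have hW3 : d ≤ W ^ 3 := hdW.trans (le_self_pow₀ hW1 (by norm_num))
  have hW31 : 1 ≤ W ^ 3 := one_le_pow₀ hW1
  have hW41 : 1 ≤ W ^ 4 := one_le_pow₀ hW1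
  have hWH : W ≤ H := by
    calc W = W * 1 * 1 := by ring
      _ ≤ W * W ^ 4 * v := by
          refine mul_le_mul (mul_le_mul_of_nonneg_left hW41 hW0.le) hv zero_le_one ?_
          exact mul_nonneg hW0.le (by linarith)
      _ = W ^ 5 * v := by ring
      _ ≤ H := hH
  have hH0 : 0 < H := by linarith
  have hHX : H ≤ X := le_trans (le_mul_of_one_le_right hH0.le hW1) hX
  have hX0 : 0 < X := by linarith
  have hdv0 : 0 < d * v := mul_pos hd0 hv0
  -- `W d v ≤ X` and `H v ≤ X`
  have hWdv : W * d * v ≤ X := by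
    have h1 : W * d * v ≤ W * W * W := by
      refine mul_le_mul (mul_le_mul_of_nonneg_left hdW hW0.le) hvW hv0.le ?_
      exact mul_nonneg hW0.le hW0.le
    have h2 : W * W * W ≤ W ^ 5 * v := by
      calc W * W * W = W ^ 3 * 1 * 1 := by ring
        _ ≤ W ^ 3 * W ^ 2 * v := by
            refine mul_le_mul (mul_le_mul_of_nonneg_left (one_le_pow₀ hW1) (by positivity)) hv
              zero_le_one ?_
            exact mul_nonneg (by positivity) (by positivity)
        _ = W ^ 5 * v := by ring
    linarith [hH.trans hHX]
  have hHv : H * v ≤ X := le_trans (mul_le_mul_of_nonneg_left hvW hH0.le) hX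
  -- the unit `U = HX/(dv)` and the basic comparison `L X/v ≤ U`
  have hU0 : 0 < H * X / (d * v) := div_pos (mul_pos hH0 hX0) hdv0
  have hLd : L * d ≤ H := by rwa [le_div_iff₀ hd0] at hL
  have hLXv : L * X / v ≤ H * X / (d * v) := by
    rw [div_le_div_iff₀ hv0 hdv0]
    have : L * X * (d * v) = (L * d) * (X * v) := by ring
    rw [this]
    have : H * X * v = H * (X * v) := by ring
    rw [this]
    exact mul_le_mul_of_nonneg_right hLd (by positivity)
  -- `h₀ = H/(W⁴ v) ≥ W ≥ 2`, `T + 1 ≤ 3 q h₀`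
  have hh₀0 : 0 < H / (W ^ 4 * v) := div_pos hH0 (by positivity)
  have hh₀W : W ≤ H / (W ^ 4 * v) := by
    rw [le_div_iff₀ (by positivity)]
    calc W * (W ^ 4 * v) = W ^ 5 * v := by ring
      _ ≤ H := hH
  have hqh₀2 : 2 * q ≤ q * (H / (W ^ 4 * v)) := by
    have : (2 : ℝ) ≤ H / (W ^ 4 * v) := hW.trans hh₀W
    nlinarith
  have hT1 : T + 1 ≤ 3 * (q * (H / (W ^ 4 * v))) := by rw [hT]; nlinarith
  have hLp0 : 0 ≤ L / p := div_nonneg hL0.le hp0.le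
  have hLp1 : 0 ≤ L / p + 1 := by linarith
  have hdN0 : 0 ≤ d * N := mul_nonneg hd0.le hN0
  -- (i) `(L/p + 1) d N (T+1) ≤ 18 U`
  have h1 : (L / p + 1) * d * (N * (T + 1)) ≤ 18 * (H * X / (d * v)) := by
    have e : (L / p + 1) * d * (N * (T + 1)) = (T + 1) * ((L / p + 1) * (d * N)) := by ring
    rw [e]
    have hqh0 : 0 ≤ 3 * (q * (H / (W ^ 4 * v))) := by positivity
    have s1 : (T + 1) * ((L / p + 1) * (d * N)) ≤ 3 * (q * (H / (W ^ 4 * v))) * ((L / p + 1) * (2 * X)) :=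
      mul_le_mul hT1 (mul_le_mul_of_nonneg_left hdN hLp1) (mul_nonneg hLp1 hdN0) hqh0
    refine s1.trans ?_
    have e2 : 3 * (q * (H / (W ^ 4 * v))) * ((L / p + 1) * (2 * X)) =
        6 * X * (q * (H / (W ^ 4 * v)) * (L / p)) + 6 * X * (q * (H / (W ^ 4 * v))) := by ring
    rw [e2]
    -- `q h₀ (L/p) ≤ 2L/v ≤ 2 H/(dv)`
    have hA : q * (H / (W ^ 4 * v)) * (L / p) ≤ 2 * (H / (d * v)) := by
      have t1 : q * (H / (W ^ 4 * v)) * (L / p) ≤ 2 * p / v * (L / p) :=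
        mul_le_mul_of_nonneg_right hp3 hLp0
      have t2 : 2 * p / v * (L / p) = 2 * L / v := by
        field_simp
      have t3 : 2 * L / v ≤ 2 * (H / d) / v := div_le_div_of_nonneg_right (by linarith) hv0.le
      have t4 : 2 * (H / d) / v = 2 * (H / (d * v)) := by rw [mul_div_assoc, div_div]
      linarith
    -- `q h₀ ≤ W h₀ = H/(W³ v) ≤ H/(dv)`
    have hB : q * (H / (W ^ 4 * v)) ≤ H / (d * v) := by
      have t1 : q * (H / (W ^ 4 * v)) ≤ W * (H / (W ^ 4 * v)) :=
        mul_le_mul_of_nonneg_right hqW hh₀0.le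
      have t2 : W * (H / (W ^ 4 * v)) = H / (W ^ 3 * v) := by
        field_simp
      have t3 : H / (W ^ 3 * v) ≤ H / (d * v) :=
        div_le_div_of_nonneg_left hH0.le hdv0 (mul_le_mul_of_nonneg_right hW3 hv0.le)
      linarith
    have e3 : 18 * (H * X / (d * v)) = 6 * X * (2 * (H / (d * v))) + 6 * X * (H / (d * v)) := by
      ring
    rw [e3]
    have hX6 : 0 ≤ 6 * X := by linarith
    exact add_le_add (mul_le_mul_of_nonneg_left hA hX6) (mul_le_mul_of_nonneg_left hB hX6)
  -- (ii) `(L/p + 1) d (3 p q M₀) ≤ 12 U`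
  have h2 : (L / p + 1) * d * (3 * p * q * M₀) ≤ 12 * (H * X / (d * v)) := by
    have e1 : (L / p + 1) * d * (3 * p * q * M₀) = 3 * q * ((L + p) * (d * M₀)) := by
      field_simp
    rw [e1]
    have hdM₀0 : 0 ≤ d * M₀ := mul_nonneg hd0.le hM₀0
    have s1 : (L + p) * (d * M₀) ≤ (2 * L) * (X / (W * v) + d) :=
      mul_le_mul (by linarith) hdM₀ hdM₀0 (by linarith)
    have s2 : 3 * q * ((L + p) * (d * M₀)) ≤ 3 * q * ((2 * L) * (X / (W * v) + d)) :=
      mul_le_mul_of_nonneg_left s1 (by linarith)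
    refine s2.trans ?_
    have e2 : 3 * q * ((2 * L) * (X / (W * v) + d)) = 6 * (q / W) * (L * X / v) + 6 * q * (L * d) := by
      field_simp
      ring
    rw [e2]
    have hqW1 : q / W ≤ 1 := (div_le_one hW0).mpr hqW
    have hA : 6 * (q / W) * (L * X / v) ≤ 6 * (H * X / (d * v)) := by
      have t1 : 6 * (q / W) * (L * X / v) ≤ 6 * 1 * (L * X / v) := by
        refine mul_le_mul_of_nonneg_right (mul_le_mul_of_nonneg_left hqW1 (by norm_num)) ?_
        exact div_nonneg (mul_nonneg hL0.le hX0.le) hv0.le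
      linarith [hLXv]
    have hB : 6 * q * (L * d) ≤ 6 * (H * X / (d * v)) := by
      have t1 : 6 * q * (L * d) ≤ 6 * W * H :=
        mul_le_mul (by linarith) hLd (mul_nonneg hL0.le hd0.le) (by linarith)
      have t2 : W * H ≤ H * X / (d * v) := by
        rw [le_div_iff₀ hdv0]
        have : W * H * (d * v) = H * (W * d * v) := by ring
        rw [this]
        exact mul_le_mul_of_nonneg_left hWdv hH0.le
      linarith
    linarith
  -- (iii) `(L/p + 1) d (3 p q · 2√C N/(Wv)) ≤ 24 √C U`
  have h3 : (L / p + 1) * d * (3 * p * q * (2 * Real.sqrt C * N / (W * v))) ≤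
      24 * Real.sqrt C * (H * X / (d * v)) := by
    have e1 : (L / p + 1) * d * (3 * p * q * (2 * Real.sqrt C * N / (W * v))) =
        6 * Real.sqrt C * (q / W) * ((L + p) * (d * N) / v) := by
      field_simp
      ring
    rw [e1]
    have hqW1 : q / W ≤ 1 := (div_le_one hW0).mpr hqW
    have hqW0 : 0 ≤ q / W := div_nonneg hq0.le hW0.le
    have s0 : 0 ≤ (L + p) * (d * N) / v := div_nonneg (mul_nonneg (by linarith) hdN0) hv0.le
    have s1 : (L + p) * (d * N) / v ≤ (2 * L) * (2 * X) / v :=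
      div_le_div_of_nonneg_right (mul_le_mul (by linarith) hdN hdN0 (by linarith)) hv0.le
    have s2 : (2 * L) * (2 * X) / v = 4 * (L * X / v) := by ring
    calc 6 * Real.sqrt C * (q / W) * ((L + p) * (d * N) / v)
        ≤ 6 * Real.sqrt C * 1 * ((2 * L) * (2 * X) / v) := by
          refine mul_le_mul (mul_le_mul_of_nonneg_left hqW1 (by positivity)) s1 s0 (by positivity)
      _ = 24 * Real.sqrt C * (L * X / v) := by rw [s2]; ring
      _ ≤ 24 * Real.sqrt C * (H * X / (d * v)) := mul_le_mul_of_nonneg_left hLXv (by positivity)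
  -- (iv) `(L/p + 1) d L p ≤ 2 U`
  have h4 : (L / p + 1) * d * (L * p) ≤ 2 * (H * X / (d * v)) := by
    have e1 : (L / p + 1) * d * (L * p) = (L + p) * (L * d) := by
      field_simp
    rw [e1]
    have s1 : (L + p) * (L * d) ≤ (2 * L) * H := mul_le_mul (by linarith) hLd (by positivity) (by linarith)
    have s2 : L * H ≤ H * X / (d * v) := by
      rw [le_div_iff₀ hdv0]
      calc L * H * (d * v) = (L * d) * (H * v) := by ring
        _ ≤ H * X := mul_le_mul hLd hHv (by positivity) hH0.le
    linarith
  have hsum : (L / p + 1) * d * (N * (T + 1) + 3 * p * q * (M₀ + 2 * Real.sqrt C * N / (W * v)) + L * p)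
      = (L / p + 1) * d * (N * (T + 1)) + (L / p + 1) * d * (3 * p * q * M₀)
        + (L / p + 1) * d * (3 * p * q * (2 * Real.sqrt C * N / (W * v)))
        + (L / p + 1) * d * (L * p) := by ring
  rw [hsum]
  have : (32 + 24 * Real.sqrt C) * (H * X / (d * v)) = 18 * (H * X / (d * v)) + 12 * (H * X / (d * v))
      + 24 * Real.sqrt C * (H * X / (d * v)) + 2 * (H * X / (d * v)) := by ring
  rw [this]
  linarith

/-! ### The major arc bound at a fixed scale, by pieces -/

set_option maxHeartbeats 800000 in
-- one long bookkeeping proof at a fixed scale (pieces, Abel summation, re-indexing, numerics)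
open ArithmeticFunction in
/-- **The major arcs by pieces, at a fixed `X`**: for `α = a/q + θ`, `q ≤ W`, `|θ| ≤ W⁴/(qH)`,
`d ≤ W`, a set `S` invariant under the divisors of `q`, and the WEAK mean-square bound
`∑_{Y < k ≤ 2Y} |∑_{k ≤ m ≤ k+h-1, m ∈ S} λ(m)χ(m)|² ≤ C h²Y/(Wv)²` for the moduli `q/c` (`c ∣ q`), the
window lengths `h ∈ [H/(W⁴v), H]` and the blocks `X/W³ ≤ Y ≤ X` (`1 ≤ v ≤ W`; `v = W^{1/5}` in the
application), one has `∑_{k ≤ X} |∑_{k ≤ md ≤ k+H-1, m ∈ S} λ(m) e(mα)| ≤ (3+2π)(32+24√C) HX/(dv)`.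
Steps: each window `{m₀, …, m₀+n}` (`n ∈ {L-1, L}`, `L = ⌊(H-1)/d⌋`) is cut into pieces of `p`
integers, `p = L` if `|θ|L ≤ 1` and `p = ⌊1/|θ|⌋` otherwise (`norm_sum_Icc_le_sum_pieces`); Abel
summation on a piece (`norm_sum_Icc_mul_fourierChar_le`) costs `|e(θ)-1| p ≤ 2π`; the factor `d` from
`k ↦ ⌈k/d⌉` (`sum_Icc_ceilDiv_le`); the pieces start at `n₀ ≤ N + L`, `N = ⌈X/d⌉`, the range
`N < n₀ ≤ N + L` being bounded trivially; for `n₀ ≤ N` the window sums `∑_{n₀} P(n₀, j)` are bounded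
trivially for `j < q(H/(W⁴v) + 1)` and by `sum_twistedWindow_le_gen` (residues, gcd, characters,
dyadic Cauchy–Schwarz, (3.11)–(3.13)) otherwise; numerics `pieces_major_numerics`.
[cite: Lichtman2020, Proposition 3.2 (proof), pp. 10–11] -/
theorem majorArc_pieces_bound {X H d q : ℕ} {a : ℤ} {θ W v C : ℝ} (S : ℕ → Prop) [DecidablePred S]
    (hX : 1 ≤ X) (hd : 1 ≤ d) (hdW : (d : ℝ) ≤ W) (hq : 1 ≤ q) (hqW : (q : ℝ) ≤ W) (hW : 2 ≤ W)
    (hv : 1 ≤ v) (hvW : v ≤ W) (hHW : W ^ 5 * v ≤ H) (hHX : (H : ℝ) * W ≤ X)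
    (hθ : |θ| ≤ W ^ 4 / (q * H)) (hC : 0 ≤ C)
    (hS : ∀ c ∈ q.divisors, ∀ m, S (c * m) ↔ S m)
    (h34 : ∀ c ∈ q.divisors, ∀ χ : DirichletCharacter ℂ (q / c), ∀ h : ℕ,
      (H : ℝ) / (W ^ 4 * v) ≤ h → h ≤ H → ∀ Y : ℕ, (X : ℝ) / W ^ 3 ≤ Y → Y ≤ X →
        ∑ k ∈ Ioc Y (2 * Y), ‖∑ m ∈ (Icc k (k + h - 1)).filter S,
            χ (m : ZMod (q / c)) * ((liouville m : ℤ) : ℂ)‖ ^ 2 ≤ C * ((h : ℝ) ^ 2 * Y / (W * v) ^ 2)) :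
    ∑ k ∈ Icc 1 X, ‖∑ m ∈ (windowDiv d H k).filter S,
        ((liouville m : ℤ) : ℂ) * (𝐞 ((m : ℝ) * (a / q + θ)) : ℂ)‖ ≤
      (3 + 2 * Real.pi) * (32 + 24 * Real.sqrt C) * ((H : ℝ) * X / (d * v)) := by
  -- positivity bookkeeping
  have hW0 : (0 : ℝ) < W := by linarith
  have hW1 : (1 : ℝ) ≤ W := by linarith
  have hv0 : 0 < v := by linarith
  have hd0 : 0 < d := hd
  have hq0 : 0 < q := hq
  have hd1 : (1 : ℝ) ≤ d := by exact_mod_cast hd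
  have hq1 : (1 : ℝ) ≤ q := by exact_mod_cast hq
  have hdr0 : (0 : ℝ) < d := by linarith
  have hqr0 : (0 : ℝ) < q := by linarith
  have hX0 : (0 : ℝ) ≤ X := Nat.cast_nonneg X
  have hW4 : (16 : ℝ) ≤ W ^ 4 := by
    have := pow_le_pow_left₀ (by norm_num : (0 : ℝ) ≤ 2) hW 4
    norm_num at this
    exact this
  have hW41 : (1 : ℝ) ≤ W ^ 4 := by linarith
  have hWv2 : (2 : ℝ) ≤ W * v := by nlinarith
  have hHr : (W ^ 5 * v : ℝ) ≤ H := hHW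
  have hHW4 : (2 : ℝ) * W ^ 4 ≤ H := by
    calc (2 : ℝ) * W ^ 4 ≤ (W * v) * W ^ 4 := mul_le_mul_of_nonneg_right hWv2 (by positivity)
      _ = W ^ 5 * v := by ring
      _ ≤ H := hHr
  have hH32 : (32 : ℝ) ≤ H := by nlinarith
  have hH1 : 1 ≤ H := by exact_mod_cast (show (1 : ℝ) ≤ H by linarith)
  have hHr0 : (0 : ℝ) < H := by linarith
  have hHd : (16 : ℝ) ≤ (H : ℝ) / d := by
    rw [le_div_iff₀ hdr0]
    calc 16 * (d : ℝ) ≤ W ^ 4 * W := mul_le_mul hW4 hdW hdr0.le (by positivity)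
      _ = W ^ 5 * 1 := by ring
      _ ≤ W ^ 5 * v := mul_le_mul_of_nonneg_left hv (by positivity)
      _ ≤ H := hHr
  have hWH : (W : ℝ) ≤ H := by
    calc (W : ℝ) = W * 1 := (mul_one _).symm
      _ ≤ W * (2 * W ^ 3) := by
          refine mul_le_mul_of_nonneg_left ?_ hW0.le
          have : (1 : ℝ) ≤ W ^ 3 := one_le_pow₀ hW1
          linarith
      _ = 2 * W ^ 4 := by ring
      _ ≤ H := hHW4
  have hdX : (d : ℝ) ≤ X := by
    calc (d : ℝ) ≤ W := hdW
      _ ≤ H := hWH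
      _ ≤ H * W := le_mul_of_one_le_right hHr0.le hW1
      _ ≤ X := hHX
  -- `ε = |e(θ) - 1| ≤ 2π|θ|`
  obtain ⟨ε, hεdef⟩ : ∃ ε : ℝ, ε = ‖(𝐞 θ : ℂ) - 1‖ := ⟨_, rfl⟩
  have hε0 : 0 ≤ ε := by rw [hεdef]; exact norm_nonneg _
  have hεθ : ε ≤ 2 * Real.pi * |θ| := by rw [hεdef]; exact norm_fourierChar_sub_one_le θ
  -- the window sums `P(n₀, j)` with the additive character `e(·a/q)` (kept opaque)
  obtain ⟨P, hP⟩ : ∃ P : ℕ → ℕ → ℝ, ∀ n₀ j, P n₀ j = ‖∑ m ∈ (Icc n₀ (n₀ + j)).filter S,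
      ((liouville m : ℤ) : ℂ) * (𝐞 ((m : ℝ) * (a / q)) : ℂ)‖ := ⟨_, fun _ _ => rfl⟩
  have hP0 : ∀ n₀ j, 0 ≤ P n₀ j := fun n₀ j => by rw [hP]; exact norm_nonneg _
  have hg1 : ∀ m : ℕ, ‖((liouville m : ℤ) : ℂ) * (𝐞 ((m : ℝ) * (a / q)) : ℂ)‖ ≤ 1 := by
    intro m
    rw [norm_mul, norm_fourierChar, mul_one]
    exact norm_liouville_le_one m
  have hPtriv : ∀ n₀ j, P n₀ j ≤ j + 1 := fun n₀ j => by
    rw [hP]; exact norm_sum_filter_Icc_le n₀ j _ hg1 S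
  obtain ⟨f, hf⟩ : ∃ f : ℕ → ℂ, ∀ m, f m = if S m then
      ((liouville m : ℤ) : ℂ) * (𝐞 ((m : ℝ) * (a / q)) : ℂ) else 0 := ⟨_, fun _ => rfl⟩
  have hrew : ∀ s : Finset ℕ, ∑ m ∈ s.filter S,
      ((liouville m : ℤ) : ℂ) * (𝐞 ((m : ℝ) * (a / q + θ)) : ℂ) =
        ∑ m ∈ s, f m * (𝐞 ((m : ℝ) * θ) : ℂ) := by
    intro s
    rw [Finset.sum_filter]
    refine Finset.sum_congr rfl fun m _ => ?_
    rw [hf]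
    split_ifs
    · rw [mul_add, AddChar.map_add_eq_mul, Circle.coe_mul]; ring
    · rw [zero_mul]
  have hPf : ∀ s j, ‖∑ m ∈ Icc s (s + j), f m‖ = P s j := by
    intro s j
    rw [hP, Finset.sum_filter]
    simp only [hf]
  -- `L = ⌊(H-1)/d⌋ ≥ 14`
  obtain ⟨L, hLdef⟩ : ∃ L : ℕ, L = (H - 1) / d := ⟨_, rfl⟩
  have hLreal : (L : ℝ) ≤ H / d := by
    rw [hLdef]
    calc (((H - 1) / d : ℕ) : ℝ) ≤ ((H - 1 : ℕ) : ℝ) / d := Nat.cast_div_le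
      _ ≤ H / d := by
          gcongr
          exact_mod_cast Nat.sub_le H 1
  have hLge : (H : ℝ) / d - 2 ≤ L := by
    have h1 := sub_one_le_natDiv (H - 1) hd0
    have h2 : (((H - 1 : ℕ)) : ℝ) = H - 1 := by push_cast [hH1]; ring
    rw [h2, ← hLdef] at h1
    have h3 : (H : ℝ) / d - 1 ≤ ((H : ℝ) - 1) / d := by
      rw [sub_div]
      have : (1 : ℝ) / d ≤ 1 := by rw [div_le_one hdr0]; exact hd1
      linarith
    linarith
  have hL14 : (14 : ℝ) ≤ L := by linarith
  have hL1 : 1 ≤ L := by exact_mod_cast (show (1 : ℝ) ≤ L by linarith)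
  have hLr0 : (0 : ℝ) < L := by linarith
  have hLH : L + 1 ≤ H := by
    have : L ≤ H - 1 := by rw [hLdef]; exact Nat.div_le_self _ _
    omega
  have hHdL : (H : ℝ) / d ≤ 2 * L := by linarith
  -- the piece length `p`
  obtain ⟨p, hpdef⟩ : ∃ p : ℕ, p = if |θ| * L ≤ 1 then L else ⌊1 / |θ|⌋₊ := ⟨_, rfl⟩
  have hqh₀ : (q : ℝ) * ((H : ℝ) / (W ^ 4 * v)) ≤ (H : ℝ) / d / v := by
    have t1 : (q : ℝ) * ((H : ℝ) / (W ^ 4 * v)) ≤ W * ((H : ℝ) / (W ^ 4 * v)) :=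
      mul_le_mul_of_nonneg_right hqW (by positivity)
    have t2 : W * ((H : ℝ) / (W ^ 4 * v)) = (H : ℝ) / W ^ 3 / v := by
      field_simp
    have t3 : (H : ℝ) / W ^ 3 ≤ H / d := by
      apply div_le_div_of_nonneg_left hHr0.le hdr0
      exact hdW.trans (le_self_pow₀ hW1 (by norm_num))
    have t4 : (H : ℝ) / W ^ 3 / v ≤ H / d / v := div_le_div_of_nonneg_right t3 hv0.le
    linarith
  have hp_props : 1 ≤ p ∧ p ≤ L ∧ |θ| * p ≤ 1 ∧
      (q : ℝ) * ((H : ℝ) / (W ^ 4 * v)) ≤ 2 * p / v := by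
    by_cases hcase : |θ| * L ≤ 1
    · have hp : p = L := by rw [hpdef, if_pos hcase]
      rw [hp]
      refine ⟨hL1, le_rfl, hcase, hqh₀.trans ?_⟩
      exact div_le_div_of_nonneg_right hHdL hv0.le
    · have hp : p = ⌊1 / |θ|⌋₊ := by rw [hpdef, if_neg hcase]
      push Not at hcase
      have hθ0 : 0 < |θ| := by
        rcases (abs_nonneg θ).eq_or_lt with h | h
        · rw [← h, zero_mul] at hcase; linarith
        · exact h
      have hqH0 : (0 : ℝ) < q * H := by positivity
      have hinv : (q : ℝ) * H / W ^ 4 ≤ 1 / |θ| := by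
        rw [le_div_iff₀ hθ0]
        calc (q : ℝ) * H / W ^ 4 * |θ| ≤ (q : ℝ) * H / W ^ 4 * (W ^ 4 / (q * H)) :=
              mul_le_mul_of_nonneg_left hθ (by positivity)
          _ = 1 := by field_simp
      have hinv2 : (2 : ℝ) ≤ 1 / |θ| := by
        refine le_trans ?_ hinv
        rw [le_div_iff₀ (by positivity)]
        calc 2 * W ^ 4 ≤ (H : ℝ) := hHW4
          _ = 1 * H := (one_mul _).symm
          _ ≤ q * H := mul_le_mul_of_nonneg_right hq1 hHr0.le
      have hfl : 1 / |θ| - 1 ≤ (⌊1 / |θ|⌋₊ : ℝ) := by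
        have := Nat.lt_floor_add_one (1 / |θ|); linarith
      have hfl' : (⌊1 / |θ|⌋₊ : ℝ) ≤ 1 / |θ| := Nat.floor_le (by positivity)
      rw [hp]
      refine ⟨?_, ?_, ?_, ?_⟩
      · exact Nat.le_floor (by push_cast; linarith)
      · have h1 : 1 / |θ| < L := by
          rw [div_lt_iff₀ hθ0]; linarith
        exact Nat.floor_le_of_le h1.le
      · calc |θ| * (⌊1 / |θ|⌋₊ : ℝ) ≤ |θ| * (1 / |θ|) := mul_le_mul_of_nonneg_left hfl' hθ0.le
          _ = 1 := mul_one_div_cancel hθ0.ne'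
      · have h2 : (q : ℝ) * H / W ^ 4 ≤ 2 * ⌊1 / |θ|⌋₊ := by linarith
        calc (q : ℝ) * ((H : ℝ) / (W ^ 4 * v)) = (q : ℝ) * H / W ^ 4 / v := by
              field_simp
          _ ≤ 2 * ⌊1 / |θ|⌋₊ / v := div_le_div_of_nonneg_right h2 hv0.le
  obtain ⟨hp1, hpL, hθp, hp3⟩ := hp_props
  have hp0 : 0 < p := hp1
  have hpr1 : (1 : ℝ) ≤ p := by exact_mod_cast hp1
  have hprL : (p : ℝ) ≤ L := by exact_mod_cast hpL
  -- the piece functional `Φ`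
  obtain ⟨Φ, hΦdef⟩ : ∃ Φ : ℕ → ℝ, ∀ s, Φ s = P s (p - 1) + P s ((L - 1) % p) + P s (L % p)
      + ε * ∑ j ∈ range p, P s j := ⟨_, fun _ => rfl⟩
  have hΦ0 : ∀ s, 0 ≤ Φ s := fun s => by
    rw [hΦdef]
    have := Finset.sum_nonneg fun j (_ : j ∈ range p) => hP0 s j
    have := hP0 s (p - 1); have := hP0 s ((L - 1) % p); have := hP0 s (L % p)
    positivity
  -- Step 1: pieces and Abel summation on each window
  have hterm : ∀ k ∈ Icc 1 X,
      ‖∑ m ∈ (windowDiv d H k).filter S,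
          ((liouville m : ℤ) : ℂ) * (𝐞 ((m : ℝ) * (a / q + θ)) : ℂ)‖ ≤
        ∑ i ∈ range (L / p + 1), Φ ((k + d - 1) / d + i * p) := by
    intro k hk
    have hk1 : 1 ≤ k := (Finset.mem_Icc.mp hk).1
    rw [windowDiv_eq_Icc hd0 hk1]
    obtain ⟨m₀, hm₀⟩ : ∃ m₀ : ℕ, m₀ = (k + d - 1) / d := ⟨_, rfl⟩
    obtain ⟨M, hM⟩ : ∃ M : ℕ, M = (k + H - 1) / d := ⟨_, rfl⟩
    rw [← hm₀, ← hM]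
    by_cases hle : m₀ ≤ M
    · obtain ⟨n, hn⟩ := Nat.exists_eq_add_of_le hle
      -- `n ∈ {L-1, L}`
      have hnL : n ≤ L ∧ L ≤ n + 1 := by
        have e₁ := Nat.div_add_mod (k + d - 1) d
        have r₁ := Nat.mod_lt (k + d - 1) hd0
        have e₂ := Nat.div_add_mod (k + H - 1) d
        have r₂ := Nat.mod_lt (k + H - 1) hd0
        have e₃ := Nat.div_add_mod (H - 1) d
        have r₃ := Nat.mod_lt (H - 1) hd0
        rw [← hm₀] at e₁
        rw [← hM, hn, Nat.mul_add] at e₂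
        rw [← hLdef] at e₃
        have g1 : d * n < d * (L + 1) := by
          rw [Nat.mul_add, Nat.mul_one]
          generalize d * m₀ = A at e₁ e₂
          generalize d * n = B at e₂
          generalize d * L = E at e₃
          omega
        have g2 : d * L < d * (n + 2) := by
          rw [Nat.mul_add]
          generalize d * m₀ = A at e₁ e₂
          generalize d * n = B at e₂
          generalize d * L = E at e₃
          omega
        exact ⟨Nat.lt_succ_iff.mp (Nat.lt_of_mul_lt_mul_left g1),
          by have := Nat.lt_of_mul_lt_mul_left g2; omega⟩
      rw [hn, hrew]
      -- the bound for one piece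
      have hpb : ∀ s j, (j = p - 1 ∨ j = n % p) →
          ‖∑ m ∈ Icc s (s + j), f m * (𝐞 ((m : ℝ) * θ) : ℂ)‖ ≤ Φ s := by
        intro s j hj
        have hjp : j + 1 ≤ p := by
          rcases hj with h | h
          · omega
          · have := Nat.mod_lt n hp0; omega
        refine (norm_sum_Icc_mul_fourierChar_le f θ s j).trans ?_
        rw [hPf, ← hεdef]
        simp only [hPf]
        rw [hΦdef]
        have h1 : P s j ≤ P s (p - 1) + P s ((L - 1) % p) + P s (L % p) := by
          rcases hj with h | h
          · rw [h]; linarith [hP0 s ((L - 1) % p), hP0 s (L % p)]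
          · rcases Nat.eq_or_lt_of_le hnL.1 with h' | h'
            · rw [h, h']; linarith [hP0 s (p - 1), hP0 s ((L - 1) % p)]
            · have : n = L - 1 := by omega
              rw [h, this]; linarith [hP0 s (p - 1), hP0 s (L % p)]
        have h2 : ∑ j' ∈ range j, P s j' ≤ ∑ j' ∈ range p, P s j' :=
          Finset.sum_le_sum_of_subset_of_nonneg (Finset.range_subset_range.mpr (by omega))
            fun _ _ _ => hP0 _ _
        have := mul_le_mul_of_nonneg_left h2 hε0
        linarith
      have hpieces := norm_sum_Icc_le_sum_pieces (fun m => f m * (𝐞 ((m : ℝ) * θ) : ℂ)) hp1 Φ n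
        hpb m₀
      refine hpieces.trans ?_
      refine Finset.sum_le_sum_of_subset_of_nonneg (Finset.range_subset_range.mpr ?_)
        fun _ _ _ => hΦ0 _
      exact Nat.succ_le_succ (Nat.div_le_div_right hnL.1)
    · -- empty window
      have hempty : Icc m₀ M = ∅ := Finset.Icc_eq_empty_of_lt (by omega)
      rw [hempty, Finset.filter_empty, Finset.sum_empty, norm_zero]
      exact Finset.sum_nonneg fun i _ => hΦ0 _
  -- Step 2: sum over `k`, the factor `d`, and the shift by `ip ≤ L`
  obtain ⟨N, hNdef⟩ : ∃ N : ℕ, N = (X + d - 1) / d := ⟨_, rfl⟩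
  have hN1 : 1 ≤ N := by rw [hNdef]; exact (Nat.le_div_iff_mul_le hd0).mpr (by omega)
  have hNX : N ≤ X := by
    rw [hNdef, Nat.div_le_iff_le_mul_add_pred hd0]
    have := Nat.mul_le_mul_right X hd
    rw [one_mul] at this
    omega
  have hstep2 : ∑ k ∈ Icc 1 X, ‖∑ m ∈ (windowDiv d H k).filter S,
      ((liouville m : ℤ) : ℂ) * (𝐞 ((m : ℝ) * (a / q + θ)) : ℂ)‖ ≤
        ((L / p + 1 : ℕ) : ℝ) * d * ∑ n₀ ∈ Icc 1 (N + L), Φ n₀ := by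
    calc ∑ k ∈ Icc 1 X, ‖∑ m ∈ (windowDiv d H k).filter S,
          ((liouville m : ℤ) : ℂ) * (𝐞 ((m : ℝ) * (a / q + θ)) : ℂ)‖
        ≤ ∑ k ∈ Icc 1 X, ∑ i ∈ range (L / p + 1), Φ ((k + d - 1) / d + i * p) :=
          Finset.sum_le_sum hterm
      _ = ∑ i ∈ range (L / p + 1), ∑ k ∈ Icc 1 X, Φ ((k + d - 1) / d + i * p) := Finset.sum_comm
      _ ≤ ∑ _i ∈ range (L / p + 1), (d : ℝ) * ∑ n₀ ∈ Icc 1 (N + L), Φ n₀ := by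
          refine Finset.sum_le_sum fun i hi => ?_
          have h1 := sum_Icc_ceilDiv_le hd0 X (fun n₀ => Φ (n₀ + i * p)) fun n₀ => hΦ0 _
          rw [← hNdef] at h1
          refine h1.trans (mul_le_mul_of_nonneg_left ?_ (Nat.cast_nonneg d))
          have hip : i * p ≤ L := by
            have hi' := Finset.mem_range.mp hi
            calc i * p ≤ (L / p) * p := Nat.mul_le_mul_right p (by omega)
              _ ≤ L := Nat.div_mul_le_self L p
          have e1 : ∑ n₀ ∈ Icc 1 N, Φ (n₀ + i * p) = ∑ n₀ ∈ Icc (1 + i * p) (N + i * p), Φ n₀ := by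
            rw [← Finset.map_add_right_Icc, Finset.sum_map]
            rfl
          rw [e1]
          exact Finset.sum_le_sum_of_subset_of_nonneg (Finset.Icc_subset_Icc (by omega) (by omega))
            fun _ _ _ => hΦ0 _
      _ = ((L / p + 1 : ℕ) : ℝ) * d * ∑ n₀ ∈ Icc 1 (N + L), Φ n₀ := by
          rw [Finset.sum_const, Finset.card_range, nsmul_eq_mul]
          ring
  -- Step 3: the window sums `∑_{n₀ ≤ N + L} P(n₀, j)` for `j < p`
  obtain ⟨M₀, hM₀def⟩ : ∃ M₀ : ℕ, M₀ = ⌈(X : ℝ) / (d * (W * v))⌉₊ := ⟨_, rfl⟩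
  have hXr1 : (1 : ℝ) ≤ X := by exact_mod_cast hX
  have hWv0 : (0 : ℝ) < W * v := by positivity
  have hh₀0 : (0 : ℝ) ≤ (H : ℝ) / (W ^ 4 * v) := by positivity
  have hdWv0 : (0 : ℝ) < d * (W * v) := by positivity
  have hM₀1 : 1 ≤ M₀ := by
    rw [hM₀def, Nat.one_le_ceil_iff]
    exact div_pos (by linarith) hdWv0
  have hM₀ge : (X : ℝ) / W ^ 3 ≤ M₀ := by
    calc (X : ℝ) / W ^ 3 ≤ X / (d * (W * v)) := by
          apply div_le_div_of_nonneg_left hX0 hdWv0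
          calc (d : ℝ) * (W * v) ≤ W * (W * W) :=
                mul_le_mul hdW (mul_le_mul_of_nonneg_left hvW hW0.le) (by positivity) hW0.le
            _ = W ^ 3 := by ring
      _ ≤ M₀ := by rw [hM₀def]; exact Nat.le_ceil _
  have hdM₀ : (d : ℝ) * M₀ ≤ X / (W * v) + d := by
    have h1 : (M₀ : ℝ) < X / (d * (W * v)) + 1 := by
      rw [hM₀def]; exact Nat.ceil_lt_add_one (by positivity)
    have h2 : (d : ℝ) * M₀ ≤ d * (X / (d * (W * v)) + 1) :=
      mul_le_mul_of_nonneg_left h1.le hdr0.le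
    have h3 : (d : ℝ) * (X / (d * (W * v)) + 1) = X / (W * v) + d := by
      field_simp
    linarith
  have hdN : (d : ℝ) * N ≤ 2 * X := by
    have h1 : d * N ≤ X + d - 1 := by rw [hNdef]; exact Nat.mul_div_le (X + d - 1) d
    have h2 : ((d * N : ℕ) : ℝ) ≤ ((X + d - 1 : ℕ) : ℝ) := by exact_mod_cast h1
    push_cast [show 1 ≤ X + d by omega] at h2
    linarith
  obtain ⟨T, hT⟩ : ∃ T : ℝ, T = (q : ℝ) * ((H : ℝ) / (W ^ 4 * v) + 1) := ⟨_, rfl⟩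
  have hT0 : 0 ≤ T := by rw [hT]; positivity
  obtain ⟨R, hR⟩ : ∃ R : ℝ, R = (M₀ : ℝ) + 2 * Real.sqrt C * N / (W * v) := ⟨_, rfl⟩
  have hR0 : 0 ≤ R := by rw [hR]; positivity
  obtain ⟨Pstar, hPstar⟩ : ∃ Pstar : ℝ, Pstar = (N : ℝ) * (T + 1) + 3 * (p : ℝ) * q * R + (L : ℝ) * p :=
    ⟨_, rfl⟩
  have hNT0 : 0 ≤ (N : ℝ) * (T + 1) := mul_nonneg (Nat.cast_nonneg N) (by linarith)
  have hPstar0 : 0 ≤ Pstar := by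
    rw [hPstar]
    have : 0 ≤ 3 * (p : ℝ) * q * R := by positivity
    have : 0 ≤ (L : ℝ) * p := by positivity
    linarith
  have hIcc : ∀ n : ℕ, Icc 1 n = Ioc 0 n := fun n => by ext m; simp; omega
  have h𝒫 : ∀ j : ℕ, j + 1 ≤ p → ∑ n₀ ∈ Icc 1 (N + L), P n₀ j ≤ Pstar := by
    intro j hjp
    have hjr : (j : ℝ) + 1 ≤ p := by exact_mod_cast hjp
    rw [hIcc, ← Finset.sum_Ioc_consecutive _ (Nat.zero_le N) (Nat.le_add_right N L), ← hIcc]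
    -- the tail `N < n₀ ≤ N + L`, trivially
    have htail : ∑ n₀ ∈ Ioc N (N + L), P n₀ j ≤ (L : ℝ) * p := by
      calc ∑ n₀ ∈ Ioc N (N + L), P n₀ j ≤ ∑ _n₀ ∈ Ioc N (N + L), ((j : ℝ) + 1) :=
            Finset.sum_le_sum fun n₀ _ => hPtriv n₀ j
        _ = L * ((j : ℝ) + 1) := by
            rw [Finset.sum_const, Nat.card_Ioc, nsmul_eq_mul, Nat.add_sub_cancel_left]
        _ ≤ L * p := mul_le_mul_of_nonneg_left hjr (Nat.cast_nonneg L)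
    -- the head `n₀ ≤ N`
    have hhead : ∑ n₀ ∈ Icc 1 N, P n₀ j ≤ (N : ℝ) * (T + 1) + 3 * (p : ℝ) * q * R := by
      by_cases hjT : (j : ℝ) < T
      · have h1 : ∑ n₀ ∈ Icc 1 N, P n₀ j ≤ (N : ℝ) * (j + 1) := by
          calc ∑ n₀ ∈ Icc 1 N, P n₀ j ≤ ∑ _n₀ ∈ Icc 1 N, ((j : ℝ) + 1) :=
                Finset.sum_le_sum fun n₀ _ => hPtriv n₀ j
            _ = N * ((j : ℝ) + 1) := by
                rw [Finset.sum_const, Nat.card_Icc, nsmul_eq_mul, Nat.add_sub_cancel]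
        have h2 : (N : ℝ) * (j + 1) ≤ N * (T + 1) :=
          mul_le_mul_of_nonneg_left (by linarith) (Nat.cast_nonneg N)
        have h3 : 0 ≤ 3 * (p : ℝ) * q * R := by positivity
        linarith
      · push Not at hjT
        rw [hT] at hjT
        have hjH : j + 1 ≤ H := by omega
        have h34' : ∀ c ∈ q.divisors, ∀ χ : DirichletCharacter ℂ (q / c), ∀ h : ℕ,
            (H : ℝ) / (W ^ 4 * v) ≤ h → h ≤ H → ∀ Y : ℕ, M₀ ≤ Y → Y ≤ N →
              ∑ k ∈ Ioc Y (2 * Y), ‖∑ m ∈ (Icc k (k + h - 1)).filter S,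
                χ (m : ZMod (q / c)) * ((liouville m : ℤ) : ℂ)‖ ^ 2 ≤
                  C * ((h : ℝ) ^ 2 * Y / (W * v) ^ 2) := by
          intro c hc χ h hh1 hh2 Y hY1 hY2
          have hY1' : (M₀ : ℝ) ≤ Y := by exact_mod_cast hY1
          exact h34 c hc χ h hh1 hh2 Y (hM₀ge.trans hY1') (hY2.trans hNX)
        have hU := sum_twistedWindow_le_gen (a := a) S hq0 hS hWv0 hC hh₀0 hM₀1 hN1 hjT hjH h34'
        have hPsum : ∑ n₀ ∈ Icc 1 N, ‖∑ m ∈ (Icc n₀ (n₀ + j)).filter S,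
            ((liouville m : ℤ) : ℂ) * (𝐞 ((m : ℝ) * (a / q)) : ℂ)‖ = ∑ n₀ ∈ Icc 1 N, P n₀ j :=
          Finset.sum_congr rfl fun n₀ _ => (hP n₀ j).symm
        rw [hPsum, ← hR] at hU
        have hjp' : (j : ℝ) ≤ p := by linarith
        have hqR : 0 ≤ 3 * (q : ℝ) * R := by positivity
        have h1 : (3 : ℝ) * j * q * R ≤ 3 * p * q * R := by
          have e1 : (3 : ℝ) * j * q * R = j * (3 * q * R) := by ring
          have e2 : (3 : ℝ) * p * q * R = p * (3 * q * R) := by ring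
          rw [e1, e2]
          exact mul_le_mul_of_nonneg_right hjp' hqR
        linarith
    rw [hPstar]
    linarith
  -- Step 4: `∑_{n₀ ≤ N+L} Φ(n₀) ≤ (3 + 2π) P*`
  have hΨ : ∑ n₀ ∈ Icc 1 (N + L), Φ n₀ ≤ (3 + 2 * Real.pi) * Pstar := by
    have hexp : ∑ n₀ ∈ Icc 1 (N + L), Φ n₀ = ∑ n₀ ∈ Icc 1 (N + L), P n₀ (p - 1)
        + ∑ n₀ ∈ Icc 1 (N + L), P n₀ ((L - 1) % p) + ∑ n₀ ∈ Icc 1 (N + L), P n₀ (L % p)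
        + ε * ∑ j ∈ range p, ∑ n₀ ∈ Icc 1 (N + L), P n₀ j := by
      simp only [hΦdef]
      rw [Finset.sum_add_distrib, Finset.sum_add_distrib, Finset.sum_add_distrib, ← Finset.mul_sum,
        Finset.sum_comm]
    rw [hexp]
    have h1 := h𝒫 (p - 1) (by omega)
    have h2 := h𝒫 ((L - 1) % p) (by have := Nat.mod_lt (L - 1) hp0; omega)
    have h3 := h𝒫 (L % p) (by have := Nat.mod_lt L hp0; omega)
    have h4 : ∑ j ∈ range p, ∑ n₀ ∈ Icc 1 (N + L), P n₀ j ≤ p * Pstar := by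
      calc ∑ j ∈ range p, ∑ n₀ ∈ Icc 1 (N + L), P n₀ j ≤ ∑ _j ∈ range p, Pstar :=
            Finset.sum_le_sum fun j hj => h𝒫 j (by have := Finset.mem_range.mp hj; omega)
        _ = p * Pstar := by rw [Finset.sum_const, Finset.card_range, nsmul_eq_mul]
    have hεp : ε * p ≤ 2 * Real.pi := by
      calc ε * p ≤ 2 * Real.pi * |θ| * p := mul_le_mul_of_nonneg_right hεθ (Nat.cast_nonneg p)
        _ = 2 * Real.pi * (|θ| * p) := by ring
        _ ≤ 2 * Real.pi * 1 := mul_le_mul_of_nonneg_left hθp (by positivity)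
        _ = 2 * Real.pi := mul_one _
    have h5 : ε * ∑ j ∈ range p, ∑ n₀ ∈ Icc 1 (N + L), P n₀ j ≤ 2 * Real.pi * Pstar := by
      calc ε * ∑ j ∈ range p, ∑ n₀ ∈ Icc 1 (N + L), P n₀ j ≤ ε * (p * Pstar) :=
            mul_le_mul_of_nonneg_left h4 hε0
        _ = (ε * p) * Pstar := by ring
        _ ≤ 2 * Real.pi * Pstar := mul_le_mul_of_nonneg_right hεp hPstar0
    linarith
  -- Step 5: the numerics
  have hfin := pieces_major_numerics (N := (N : ℝ)) (M₀ := (M₀ : ℝ)) (C := C) hW hv hvW hd1 hdW hq1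
    hqW hHr hHX hpr1 hprL hLreal (Nat.cast_nonneg N) hdN (Nat.cast_nonneg M₀) hdM₀ hT hp3
  rw [← hR] at hfin
  have hLp : (((L / p + 1 : ℕ)) : ℝ) ≤ (L : ℝ) / p + 1 := by
    have h1 : (((L / p : ℕ)) : ℝ) ≤ (L : ℝ) / p := Nat.cast_div_le
    push_cast
    linarith
  have hsum0 : 0 ≤ ∑ n₀ ∈ Icc 1 (N + L), Φ n₀ := Finset.sum_nonneg fun n₀ _ => hΦ0 n₀
  calc ∑ k ∈ Icc 1 X, ‖∑ m ∈ (windowDiv d H k).filter S,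
        ((liouville m : ℤ) : ℂ) * (𝐞 ((m : ℝ) * (a / q + θ)) : ℂ)‖
      ≤ ((L / p + 1 : ℕ) : ℝ) * d * ∑ n₀ ∈ Icc 1 (N + L), Φ n₀ := hstep2
    _ ≤ ((L : ℝ) / p + 1) * d * ((3 + 2 * Real.pi) * Pstar) := by
        refine mul_le_mul (mul_le_mul_of_nonneg_right hLp hdr0.le) hΨ hsum0 ?_
        exact mul_nonneg (by positivity) hdr0.le
    _ = (3 + 2 * Real.pi) * (((L : ℝ) / p + 1) * d *
          ((N : ℝ) * (T + 1) + 3 * (p : ℝ) * q * R + (L : ℝ) * p)) := by rw [hPstar]; ring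
    _ ≤ (3 + 2 * Real.pi) * ((32 + 24 * Real.sqrt C) * ((H : ℝ) * X / (d * v))) :=
        mul_le_mul_of_nonneg_left hfin (by positivity)
    _ = (3 + 2 * Real.pi) * (32 + 24 * Real.sqrt C) * ((H : ℝ) * X / (d * v)) := by ring

/-! ### Growth lemmas -/

/-- `(log X)^{2/3} ≤ (log X)/2` once `log X ≥ 8`. [folklore] -/
theorem rpow_two_thirds_le_half {ℓ : ℝ} (hℓ : 8 ≤ ℓ) : ℓ ^ (2 / 3 : ℝ) ≤ ℓ / 2 := by
  have hℓ0 : 0 < ℓ := by linarith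
  have h13 : (2 : ℝ) ≤ ℓ ^ (1 / 3 : ℝ) := by
    have h1 : (8 : ℝ) ^ (1 / 3 : ℝ) ≤ ℓ ^ (1 / 3 : ℝ) := Real.rpow_le_rpow (by norm_num) hℓ (by norm_num)
    have h2 : (8 : ℝ) ^ (1 / 3 : ℝ) = 2 := by
      rw [show (8 : ℝ) = 2 ^ (3 : ℝ) by norm_num, ← Real.rpow_mul (by norm_num)]; norm_num
    linarith
  have e : ℓ = ℓ ^ (2 / 3 : ℝ) * ℓ ^ (1 / 3 : ℝ) := by
    rw [← Real.rpow_add hℓ0]; norm_num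
  have h0 : 0 ≤ ℓ ^ (2 / 3 : ℝ) := Real.rpow_nonneg hℓ0.le _
  nlinarith

/-- In the regime `H ≤ exp((log X)^{2/3})`: eventually `H X · (log X)^K ≤ X`. [folklore] -/
theorem eventually_H_mul_rpow_log_le {H : ℕ → ℕ}
    (hHexp : ∀ᶠ X : ℕ in atTop, (H X : ℝ) ≤ Real.exp (Real.log X ^ (2 / 3 : ℝ))) (K : ℝ) :
    ∀ᶠ X : ℕ in atTop, (H X : ℝ) * Real.log X ^ K ≤ X := by
  have hε : 0 < 1 / (2 * (|K| + 1)) := by positivity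
  filter_upwards [hHexp, tendsto_log_natCast.eventually_ge_atTop 8, eventually_gt_atTop 0,
    (tendsto_natCast_atTop_atTop (R := ℝ)).eventually (eventually_loglog_le 1 _ one_pos hε)]
    with X hHX hℓ8 hX0 hll
  have hX0' : (0 : ℝ) < X := by exact_mod_cast hX0
  set ℓ := Real.log (X : ℝ) with hℓ
  have hℓ0 : 0 < ℓ := by linarith
  have hlogℓ : 0 ≤ Real.log ℓ := Real.log_nonneg (by linarith)
  rw [Real.rpow_one] at hll
  -- `K log ℓ ≤ ℓ/2`
  have hK : K * Real.log ℓ ≤ ℓ / 2 := by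
    have h1 : K * Real.log ℓ ≤ |K| * Real.log ℓ := mul_le_mul_of_nonneg_right (le_abs_self K) hlogℓ
    have h2 : |K| * Real.log ℓ ≤ |K| * (1 / (2 * (|K| + 1)) * ℓ) :=
      mul_le_mul_of_nonneg_left hll (abs_nonneg K)
    have h3 : |K| * (1 / (2 * (|K| + 1)) * ℓ) ≤ ℓ / 2 := by
      rw [show |K| * (1 / (2 * (|K| + 1)) * ℓ) = (|K| / (|K| + 1)) * (ℓ / 2) by field_simp]
      have : |K| / (|K| + 1) ≤ 1 := by
        rw [div_le_one (by positivity)]; linarith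
      exact (mul_le_mul_of_nonneg_right this (by linarith)).trans (by linarith)
    linarith
  calc (H X : ℝ) * ℓ ^ K ≤ Real.exp (ℓ ^ (2 / 3 : ℝ)) * Real.exp (K * Real.log ℓ) := by
        rw [Real.rpow_def_of_pos hℓ0, mul_comm (Real.log ℓ)]
        exact mul_le_mul_of_nonneg_right hHX (Real.exp_pos _).le
    _ ≤ Real.exp (ℓ / 2) * Real.exp (ℓ / 2) := by
        gcongr
        exact rpow_two_thirds_le_half hℓ8
    _ = X := by rw [← Real.exp_add, add_halves, hℓ, Real.exp_log hX0']

/-! ### The weak major arc estimate from the weak mean square -/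

open ArithmeticFunction in
/-- **The major arcs of Proposition 2.3 from the WEAK Proposition 3.4** (asymptotic form of
`majorArc_pieces_bound`): given `A > 5`, `δ > 0`, `H` with `log H/log log X → ∞` and
`H ≤ exp((log X)^{2/3})`, if the mean square of Proposition 3.4 satisfies the weak bound
`∫_Y^{2Y} |∑_{x ≤ m ≤ x+h, m ∈ S} λ(m)χ(m)|² dx ≪ h²Y/(log X)^{12A/5}` for `q ≤ W = (log X)^A`,
`χ (mod q)`, `h ∈ [H/(log X)^{21A/5}, H]`, `Y ∈ [X/(log X)^{6A}, X]` (`S` the PRINTED typical set), then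
`sup_{α ∈ 𝔐} ∫_0^X |∑_{x ≤ nd ≤ x+H, n ∈ S_d} λ(n)e(nα)| dx ≪ HX/(d (log X)^{A/5})` for every
`d ≤ W` — enough for Proposition 2.3 (`d ≥ d^{3/4}`), though weaker than the printed Proposition 3.2.
For `α = a/q + θ ∈ 𝔐(q)`: discretisation (`integral_window_div_eq_sum`), `S(cm) ↔ S(m)` for
`c ∣ q` (`c ≤ W < P₁, P₂`), the hypothesis discretised on integer blocks
(`integral_window_eq_sum_Ioc`), and `majorArc_pieces_bound` with `W = (log X)^A`, `v = (log X)^{A/5}`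
(its side conditions `W⁵v = (log X)^{26A/5} ≤ H`, `HW ≤ X` hold eventually).
[cite: Lichtman2020, Proposition 3.2 and §3.2, pp. 10–11] -/
theorem majorArcWeak_of_meanSquareWeak (A : ℝ) (hA : 5 < A) (δ : ℝ) (hδ : 0 < δ) (H : ℕ → ℕ)
    (hH : Tendsto (fun X : ℕ => Real.log (H X) / Real.log (Real.log X)) atTop atTop)
    (hHexp : ∀ᶠ X : ℕ in atTop, (H X : ℝ) ≤ Real.exp (Real.log X ^ (2 / 3 : ℝ)))
    (h34w : ∃ C : ℝ, ∀ᶠ X : ℕ in atTop, ∀ q : ℕ, 1 ≤ q → (q : ℝ) ≤ Real.log X ^ A →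
      ∀ χ : DirichletCharacter ℂ q, ∀ h : ℕ,
        (H X : ℝ) / Real.log X ^ (21 / 5 * A) ≤ h → h ≤ H X →
        ∀ Y : ℝ, (X : ℝ) / Real.log X ^ (6 * A) ≤ Y → Y ≤ X →
          ∫ x in Y..2 * Y,
              ‖∑ m ∈ (Icc ⌈x⌉₊ ⌊x + h⌋₊).filter (lichtmanTypical X A δ (H X)),
                  ((liouville m : ℤ) : ℂ) * χ (m : ZMod q)‖ ^ 2
            ≤ C * ((h : ℝ) ^ 2 * Y / Real.log X ^ (12 / 5 * A))) :
    ∃ C : ℝ, ∀ᶠ X : ℕ in atTop, ∀ d : ℕ, 1 ≤ d → (d : ℝ) ≤ Real.log X ^ A →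
      ∀ α ∈ lichtmanMajorArcs (Real.log X ^ A) ((H X : ℝ) / Real.log X ^ (4 * A)),
        ∫ x in (0 : ℝ)..X,
            ‖liouvilleTwistedSum
                ((Icc ⌈x / d⌉₊ ⌊(x + H X) / d⌋₊).filter (lichtmanTypical X A δ (H X))) α‖
          ≤ C * ((H X : ℝ) * X / ((d : ℝ) * Real.log X ^ (A / 5))) := by
  have hA0 : 0 < A := by linarith
  obtain ⟨C, hC⟩ := h34w
  obtain ⟨C', hC'⟩ : ∃ C' : ℝ, C' = max C 0 := ⟨_, rfl⟩
  have hC'0 : 0 ≤ C' := by rw [hC']; exact le_max_right _ _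
  have hCC' : C ≤ C' := by rw [hC']; exact le_max_left _ _
  refine ⟨(3 + 2 * Real.pi) * (32 + 24 * Real.sqrt C'), ?_⟩
  -- eventual inequalities
  have hW2 : ∀ᶠ X : ℕ in atTop, 2 ≤ Real.log X ^ A :=
    ((tendsto_rpow_atTop hA0).comp tendsto_log_natCast).eventually_ge_atTop 2
  have hH26 : ∀ᶠ X : ℕ in atTop, Real.log X ^ (26 / 5 * A) ≤ H X :=
    eventually_rpow_log_le_H hH (26 / 5 * A)
  have hHX : ∀ᶠ X : ℕ in atTop, (H X : ℝ) * Real.log X ^ A ≤ X := eventually_H_mul_rpow_log_le hHexp A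
  have hP2 : ∀ᶠ X : ℕ in atTop, Real.log X ^ A < Real.exp (Real.log X ^ (2 / 3 + δ / 2)) := by
    filter_upwards [eventually_sqrtW_lt_P2 (2 * A) δ hδ] with X hX
    rwa [show 2 * A / 2 = A by ring] at hX
  have hlog1 : ∀ᶠ X : ℕ in atTop, 1 < Real.log X := tendsto_log_natCast.eventually_gt_atTop 1
  filter_upwards [hC, hW2, hH26, hHX, hP2, hlog1, eventually_ge_atTop 1] with X hCX hW2X hH26X hHXX
    hP2X hlog1X hX1 d hd hdW α hα
  have hL0 : 0 < Real.log X := by linarith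
  have hL1 : 1 ≤ Real.log X := hlog1X.le
  -- powers of `ℓ = log X`: `W = ℓ^A`, `v = ℓ^{A/5}`
  have hpow : ∀ n : ℕ, Real.log X ^ ((n : ℝ) * A) = (Real.log X ^ A) ^ n := fun n => by
    rw [mul_comm, Real.rpow_mul hL0.le, Real.rpow_natCast]
  have h4 : Real.log X ^ (4 * A) = (Real.log X ^ A) ^ 4 := by exact_mod_cast hpow 4
  set W : ℝ := Real.log X ^ A with hWdef
  set v : ℝ := Real.log X ^ (A / 5) with hvdef
  have hW0 : 0 < W := by linarith
  have hv1 : 1 ≤ v := Real.one_le_rpow hL1 (by positivity)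
  have hvW : v ≤ W := Real.rpow_le_rpow_of_exponent_le hL1 (by linarith)
  have hW4v : W ^ 4 * v = Real.log X ^ (21 / 5 * A) := by
    rw [← h4, hvdef, ← Real.rpow_add hL0]; ring_nf
  have hW5v : W ^ 5 * v = Real.log X ^ (26 / 5 * A) := by
    have h5 : Real.log X ^ (5 * A) = (Real.log X ^ A) ^ 5 := by exact_mod_cast hpow 5
    rw [← h5, hvdef, ← Real.rpow_add hL0]; ring_nf
  have hWv2 : (W * v) ^ 2 = Real.log X ^ (12 / 5 * A) := by
    rw [hWdef, hvdef, ← Real.rpow_add hL0, ← Real.rpow_natCast, ← Real.rpow_mul hL0.le]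
    push_cast
    ring_nf
  have hW3 : W ^ 3 = Real.log X ^ (3 * A) := by
    have h3 := hpow 3
    push_cast at h3
    rw [h3]
  have hW36 : W ^ 3 ≤ Real.log X ^ (6 * A) := by
    rw [hW3]; exact Real.rpow_le_rpow_of_exponent_le hL1 (by linarith)
  have hdv : (d : ℝ) * v = d * Real.log X ^ (A / 5) := rfl
  have hHW : W ^ 5 * v ≤ H X := by rw [hW5v]; exact hH26X
  have hHX0 : (0 : ℝ) < H X := lt_of_lt_of_le (by positivity) hHW
  -- the major arc datum `α = a/q + θ`
  simp only [lichtmanMajorArcs, lichtmanMajorArc, Set.mem_iUnion, Set.mem_setOf_eq] at hα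
  obtain ⟨q, ⟨hq1, hqW⟩, a, -, hθ'⟩ := hα
  have hq0 : (0 : ℝ) < q := by exact_mod_cast hq1
  obtain ⟨θ, hθdef⟩ : ∃ θ : ℝ, θ = α - a / q := ⟨_, rfl⟩
  have hαθ : (a : ℝ) / q + θ = α := by rw [hθdef]; ring
  have hθ : |θ| ≤ W ^ 4 / (q * H X) := by
    rw [h4] at hθ'
    rw [hθdef]
    calc |α - a / q| ≤ 1 / (q * (H X / W ^ 4)) := hθ'
      _ = W ^ 4 / (q * H X) := by field_simp
  -- the integral is a finite sum over `k ≤ X`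
  rw [integral_window_div_eq_sum
    (fun s => ‖liouvilleTwistedSum (s.filter (lichtmanTypical X A δ (H X))) α‖) X (H X) d hd]
  -- `S(cm) ↔ S(m)` for `c ∣ q`
  have hS : ∀ c ∈ q.divisors, ∀ m,
      lichtmanTypical X A δ (H X) (c * m) ↔ lichtmanTypical X A δ (H X) m := by
    intro c hc m
    have hc0 : c ≠ 0 := (Nat.pos_of_mem_divisors hc).ne'
    have hcW : (c : ℝ) ≤ W := le_trans (by exact_mod_cast Nat.divisor_le hc) hqW
    have hp : ∀ p ∈ c.primeFactors, (p : ℝ) ≤ W := fun p hp =>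
      le_trans (by exact_mod_cast Nat.le_of_mem_primeFactors hp) hcW
    have hWP1 : W < Real.log X ^ (33 * A) :=
      Real.rpow_lt_rpow_of_exponent_lt hlog1X (by linarith)
    unfold lichtmanTypical
    rw [hasPrimeFactorIn_mul_iff hc0 (fun p hp' => (hp p hp').trans_lt hWP1),
      hasPrimeFactorIn_mul_iff hc0 (fun p hp' => (hp p hp').trans_lt hP2X)]
  -- the weak Proposition 3.4 for the moduli `q/c`, discretised
  have h34d : ∀ c ∈ q.divisors, ∀ χ : DirichletCharacter ℂ (q / c), ∀ h : ℕ,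
      (H X : ℝ) / (W ^ 4 * v) ≤ h → h ≤ H X → ∀ Y : ℕ, (X : ℝ) / W ^ 3 ≤ Y → Y ≤ X →
        ∑ k ∈ Ioc Y (2 * Y), ‖∑ m ∈ (Icc k (k + h - 1)).filter (lichtmanTypical X A δ (H X)),
            χ (m : ZMod (q / c)) * ((liouville m : ℤ) : ℂ)‖ ^ 2 ≤
          C' * ((h : ℝ) ^ 2 * Y / (W * v) ^ 2) := by
    intro c hc χ h hh1 hh2 Y hY1 hY2
    have hc0 : 0 < c := Nat.pos_of_mem_divisors hc
    have hcq : c ∣ q := Nat.dvd_of_mem_divisors hc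
    have hq'1 : 1 ≤ q / c := Nat.div_pos (Nat.le_of_dvd hq1 hcq) hc0
    have hq'W : ((q / c : ℕ) : ℝ) ≤ W := le_trans (by exact_mod_cast Nat.div_le_self q c) hqW
    have hh1' : (H X : ℝ) / Real.log X ^ (21 / 5 * A) ≤ h := by rwa [hW4v] at hh1
    have hY1' : (X : ℝ) / Real.log X ^ (6 * A) ≤ (Y : ℝ) := by
      refine le_trans ?_ hY1
      exact div_le_div_of_nonneg_left (Nat.cast_nonneg X) (by positivity) hW36
    have hY2' : ((Y : ℕ) : ℝ) ≤ X := by exact_mod_cast hY2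
    have hint := hCX (q / c) hq'1 hq'W χ h hh1' hh2 Y hY1' hY2'
    rw [← hWv2] at hint
    have hh0 : 1 ≤ h := by
      have e1 : (1 : ℝ) ≤ (H X : ℝ) / (W ^ 4 * v) := by
        rw [le_div_iff₀ (by positivity), one_mul]
        calc W ^ 4 * v ≤ W ^ 4 * v * W := le_mul_of_one_le_right (by positivity) (by linarith)
          _ = W ^ 5 * v := by ring
          _ ≤ H X := hHW
      have : (1 : ℝ) ≤ h := e1.trans hh1
      exact_mod_cast this
    have hdisc := integral_window_eq_sum_Ioc (fun s => ‖∑ m ∈ s.filter (lichtmanTypical X A δ (H X)),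
        ((liouville m : ℤ) : ℂ) * χ (m : ZMod (q / c))‖ ^ 2) Y (2 * Y) h (by omega) hh0
    have hcast : ((2 * Y : ℕ) : ℝ) = 2 * (Y : ℝ) := by push_cast; ring
    rw [hcast] at hdisc
    rw [hdisc] at hint
    have hcomm : ∀ s : Finset ℕ, ∑ m ∈ s, χ (m : ZMod (q / c)) * ((liouville m : ℤ) : ℂ) =
        ∑ m ∈ s, ((liouville m : ℤ) : ℂ) * χ (m : ZMod (q / c)) :=
      fun s => Finset.sum_congr rfl fun m _ => mul_comm _ _
    simp only [hcomm]
    exact hint.trans (mul_le_mul_of_nonneg_right hCC' (by positivity))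
  -- the bound at the fixed scale `X`
  have hcore := majorArc_pieces_bound (X := X) (H := H X) (d := d) (q := q) (a := a) (θ := θ)
    (W := W) (v := v) (C := C') (lichtmanTypical X A δ (H X)) hX1 hd hdW hq1 hqW hW2X hv1 hvW
    hHW hHXX hθ hC'0 hS h34d
  rw [hαθ] at hcore
  simp only [liouvilleTwistedSum]
  rw [← hdv]
  exact hcore

end Lichtman2020

/-! ### Proposition 2.3 (regime `H ≤ exp((log X)^{2/3})`, printed typical set) from the weak
Proposition 3.4 -/

open Lichtman2020 ArithmeticFunction in
/-- **Proposition 2.3 in the regime `H ≤ exp((log X)^{2/3})`, for the PRINTED typical set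
`S = S(X,A,δ)` of (2.3)–(2.4), from the WEAK Proposition 3.4**: if for every `A > 5`, `δ > 0` and
`H` in the regime the mean square of `λχ𝟙_S` in almost all short intervals satisfies
`∫_Y^{2Y} |∑_{x ≤ m ≤ x+h, m ∈ S} λ(m)χ(m)|² dx ≪ h²Y/(log X)^{12A/5}` (`q ≤ (log X)^A`, `χ (mod q)`,
`h ∈ [H/(log X)^{21A/5}, H]`, `Y ∈ [X/(log X)^{6A}, X]`), then the named fact
`Lichtman2020_keyFourierEstimateLiouville'` holds.  As on p. 9 ("We shall obtain Proposition 2.3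
from the following results"): `α` may be taken in `[0,1] = 𝔐 ∪ 𝔪` by periodicity; on `𝔪` the
tree's PROVED Proposition 3.1 (`Lichtman2020_minorArcEstimate_holds`, `g = λ`) gives
`HX/(d^{3/4}W^{1/5})`; on `𝔐` the weak major arc bound `HX/(dW^{1/5}) ≤ HX/(d^{3/4}W^{1/5})`
(`majorArcWeak_of_meanSquareWeak`). [cite: Lichtman2020, Proposition 2.3 and §3, p. 9] -/
theorem Lichtman2020_keyFourierEstimateLiouville'_of_meanSquareWeak
    (h34w : ∀ A : ℝ, 5 < A → ∀ δ : ℝ, 0 < δ → ∀ H : ℕ → ℕ,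
      Tendsto (fun X : ℕ => Real.log (H X) / Real.log (Real.log X)) atTop atTop →
      (∀ᶠ X : ℕ in atTop, (H X : ℝ) ≤ Real.exp (Real.log X ^ (2 / 3 : ℝ))) →
      ∃ C : ℝ, ∀ᶠ X : ℕ in atTop, ∀ q : ℕ, 1 ≤ q → (q : ℝ) ≤ Real.log X ^ A →
        ∀ χ : DirichletCharacter ℂ q, ∀ h : ℕ,
          (H X : ℝ) / Real.log X ^ (21 / 5 * A) ≤ h → h ≤ H X →
          ∀ Y : ℝ, (X : ℝ) / Real.log X ^ (6 * A) ≤ Y → Y ≤ X →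
            ∫ x in Y..2 * Y,
                ‖∑ m ∈ (Icc ⌈x⌉₊ ⌊x + h⌋₊).filter (lichtmanTypical X A δ (H X)),
                    ((liouville m : ℤ) : ℂ) * χ (m : ZMod q)‖ ^ 2
              ≤ C * ((h : ℝ) ^ 2 * Y / Real.log X ^ (12 / 5 * A))) :
    Lichtman2020_keyFourierEstimateLiouville' := by
  intro A hA δ hδ H hH hHexp
  have hA0 : 0 < A := by linarith
  obtain ⟨C₁, hC₁⟩ := Lichtman2020_minorArcEstimate_holds A hA δ hδ.le H hH hHexp
  obtain ⟨C₂, hC₂⟩ := majorArcWeak_of_meanSquareWeak A hA δ hδ H hH hHexp (h34w A hA δ hδ H hH hHexp)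
  refine ⟨max (max C₁ C₂) 0, ?_⟩
  have hlog1 : ∀ᶠ X : ℕ in atTop, 1 ≤ Real.log X :=
    (Real.tendsto_log_atTop.comp tendsto_natCast_atTop_atTop).eventually_ge_atTop 1
  filter_upwards [hC₁, hC₂, hlog1] with X h1 h2 hL1 d hd hdW α
  set C : ℝ := max (max C₁ C₂) 0 with hC
  have hC0 : 0 ≤ C := le_max_right _ _
  have hCC₁ : C₁ ≤ C := (le_max_left _ _).trans (le_max_left _ _)
  have hCC₂ : C₂ ≤ C := (le_max_right _ _).trans (le_max_left _ _)
  have hd1 : (1 : ℝ) ≤ d := by exact_mod_cast hd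
  have hd0 : (0 : ℝ) < d := by linarith
  have hL0 : 0 < Real.log X := by linarith
  have hden₁ : 0 < (d : ℝ) ^ (3 / 4 : ℝ) * Real.log X ^ (A / 5) :=
    mul_pos (Real.rpow_pos_of_pos hd0 _) (Real.rpow_pos_of_pos hL0 _)
  have hden₂ : 0 < (d : ℝ) * Real.log X ^ (A / 5) := mul_pos hd0 (Real.rpow_pos_of_pos hL0 _)
  have hnum : 0 ≤ (H X : ℝ) * X := by positivity
  have hkey : (d : ℝ) ^ (3 / 4 : ℝ) * Real.log X ^ (A / 5) ≤ (d : ℝ) * Real.log X ^ (A / 5) := by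
    apply mul_le_mul_of_nonneg_right _ (Real.rpow_nonneg hL0.le _)
    calc (d : ℝ) ^ (3 / 4 : ℝ) ≤ (d : ℝ) ^ (1 : ℝ) :=
          Real.rpow_le_rpow_of_exponent_le hd1 (by norm_num)
      _ = d := Real.rpow_one _
  -- reduce to `α' = fract α ∈ [0, 1]`
  have hper : ∫ x in (0 : ℝ)..X, ‖liouvilleTwistedSum
      ((Icc ⌈x / d⌉₊ ⌊(x + H X) / d⌋₊).filter (lichtmanTypical X A δ (H X))) α‖ =
      ∫ x in (0 : ℝ)..X, ‖liouvilleTwistedSum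
      ((Icc ⌈x / d⌉₊ ⌊(x + H X) / d⌋₊).filter (lichtmanTypical X A δ (H X))) (Int.fract α)‖ := by
    simp_rw [liouvilleTwistedSum_fract]
  rw [hper]
  have hmem : Int.fract α ∈ Set.Icc (0 : ℝ) 1 := ⟨Int.fract_nonneg α, (Int.fract_lt_one α).le⟩
  rcases mem_majorArcs_or_minorArcs (W := Real.log X ^ A)
      (Q₁ := (H X : ℝ) / Real.log X ^ (4 * A)) hmem with hM | hm
  · -- major arcs: the weak major arc bound
    have hb := h2 d hd hdW (Int.fract α) hM
    refine hb.trans ?_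
    calc C₂ * ((H X : ℝ) * X / ((d : ℝ) * Real.log X ^ (A / 5)))
        ≤ C * ((H X : ℝ) * X / ((d : ℝ) * Real.log X ^ (A / 5))) :=
          mul_le_mul_of_nonneg_right hCC₂ (div_nonneg hnum hden₂.le)
      _ ≤ C * ((H X : ℝ) * X / ((d : ℝ) ^ (3 / 4 : ℝ) * Real.log X ^ (A / 5))) :=
          mul_le_mul_of_nonneg_left (div_le_div_of_nonneg_left hnum hden₁ hkey) hC0
  · -- minor arcs: Proposition 3.1 with `g = λ`
    have hg1 : (fun n : ℕ => ((liouville n : ℤ) : ℂ)) 1 = 1 := by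
      simp [liouville_apply_one]
    have hgmul : ∀ m n : ℕ, (fun n : ℕ => ((liouville n : ℤ) : ℂ)) (m * n) =
        (fun n : ℕ => ((liouville n : ℤ) : ℂ)) m * (fun n : ℕ => ((liouville n : ℤ) : ℂ)) n := by
      intro m n
      simp only [liouville_apply_mul, Int.cast_mul]
    have hgle : ∀ n : ℕ, ‖(fun n : ℕ => ((liouville n : ℤ) : ℂ)) n‖ ≤ 1 := by
      intro n
      simp only [Complex.norm_intCast]
      exact_mod_cast abs_liouville_le_one n
    have hb := h1 d hd hdW _ hg1 hgmul hgle (Int.fract α) hm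
    simp_rw [← liouvilleTwistedSum_eq_twistedSum] at hb
    exact hb.trans (mul_le_mul_of_nonneg_right hCC₁ (div_nonneg hnum hden₁.le))

end Literature.NumberTheory.Sieve
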